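import Mathlib
import Literature.MathematicalPhysics.QuantumFieldTheory.Balaban1983to89.B10
import Literature.MathematicalPhysics.QuantumFieldTheory.Balaban1983to89.B2

/-!
# `Balaban1983to89.B10LargeField` — [Balaban1985UV3] (T. Bałaban, *Ultraviolet stability of three-dimensional lattice
# pure gauge field theories*, CMP **102**, 255–275 (1985); cell paper B10): the geometric setting (38)–(40) of Sect. B
# with the p. 268 rule for Ω_{k+1}, and the Sect. D transfer *"The analysis of Sect. 3.C [9], which is model
# independent, show that these small factors are enough to control all sums in (41)"* — typed, its exponent
# bookkeeping kernel-checked in the paper's own variables and bound BY NAME to the [9] = [Balaban1982Higgs2] §3.C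
# arithmetic of `…Balaban1983to89.B2`

CITATION HEADER (lean-in-tree rule 2026-08-18; audit cell `pub-balaban`, PAPER SUB-CELL B10, gen 2, unit
`b2b-balaban-b10-g2`).  A SIBLING module of `…Balaban1983to89.B10` (reader r2 + sub-cell gen 1: Theorems 1, 2, the
tower carrier `TowerRun`, (41), (47), Sect. D bookkeeping) and of `…Balaban1983to89.B2` (surge node pv04: (Higgs)₂,₃ II
(3.42) and the kernel-checked arithmetic of its Sect. 3.C (3.46)–(3.54)); it imports both and modifies neither.
PDF held: `paper:balaban1985-cmp102-uv-stability-3d` (journal page = PDF page + 254; page renders re-opened for every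
quotation below: pp. 257, 262, 266, 267, 268, 272, 273, 274).

WHAT IS REPRODUCED (statement level, verbatim in the docstrings, journal page [PDF page]):
* Sect. B p. 266 [12]: the sequence of small-field domains **(38)** `Ω₁ ⊃ Ω₂ ⊃ … ⊃ Ω_k`, the separation **(39)**
  `(Lʲη)⁻¹ dist(Ω_jᶜ, Ω_{j+1}) > R(g_j)M₁`, the sets `Λ_j = Ω_j⁽ʲ⁾ ∖ Ω_{j+1}⁽ʲ⁾`, `Z_j = Ω_{j+1}⁽ʲ⁾ᶜ`, the characteristic
  functions **(40)**; pp. 267–268 [13–14]: the RULE defining Ω_{k+1} (*"a union of big blocks of the lattice T₁⁽ᵏ⁾, with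
  distances to P ∪ Ω_k⁽ᵏ⁾ᶜ greater than R(g_k)M₁"*), `Z_k = B(Λ_{k+1})ᶜ` — over a SCHEMATIC carrier `DomainSeq` (one point
  set for all scales, a block pseudo-distance per scale; cell DIVERGENCE.md D-b10.6).
* Sect. D pp. 273–274 [19–20]: the sentence delegating the control of the sums in (41) to [9] Sect. 3.C, typed as the
  leaf `LargeFieldControlVia9` = gen 1's `B10.LargeFieldControlPrinted` UNDER the parameter provisos that the delegated
  analysis states and B10 does not print (see below).

WHAT IS PROVED (kernel; re-derived bookkeeping, no content of the series asserted):
* rule ⇒ (38) (`nested38_of_rule268`), rule ⇒ (39) (`sep39_of_rule268`), rule ⇒ the scale-j large plaquettes lie in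
  Z_j and every later Z_{j'} contains their R(g_{j'})M₁-collar (`largeField_subset_Z`, `collar_all_scales`) — the
  geometric mechanism the entropy count rests on;
* the DICTIONARY between B10's logarithmic unit `x_k = 1 + log g_k⁻¹` (so `p(g_k) = b₀x_k^{p₀}`, `R(g_k) = R₁x_k^{r₀}`,
  (7) p. 257) and [9]'s `1 + log(Lᵏε)⁻¹`: `x_k = x(g) + ½ log(Lᵏε)⁻¹`, an arithmetic progression of step `½ log L`
  DOWN the scales (`xlog_gRun`, `xlog_gRun_affine`, `xlog_gRun_eq_half`, two-sided comparison `xlog_gRun_bounds`);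
* the EXPONENT BOOKKEEPING of the transfer, per large-field plaquette, in the additive per-cube organisation of [9]
  (3.52)–(3.54): gain `¼p²(g_i) = ¼b₀²x_i^{2p₀}` ((71) p. 273) against the volume penalty `Σ_{j≥i} O(log g_j⁻¹)·|collar_j|`
  ((41) p. 266 with (39)/p. 268), `|collar_j| ≍ (R(g_j)M₁)³`:
  – `penalty_le_via_B2`: the penalty is `≤ O(1)(R₁M₁)³x_i^{4r₀}/(½ log L)` — LITERALLY [9]'s (3.53) step, i.e.
    `B2.inner353_bound` at d = 3 (it needs `r₀ ≥ 2`, [9] p. 594 "and r ≥ 2");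
  – `penalty_le_B10count`: the same sum is `≤ O(1)(R₁M₁)³x_i^{3r₀+2}/(½ log L)` for EVERY `r₀ ≥ 0` (B10's own count,
    cell GAPS G-adv2-7 / G-B10-02);
  – sufficiency: the per-plaquette net exponent is `≤ −⅛p²(g_i)` if `2p₀ ≥ 3r₀ + 2` and b₀ is large
    (`perPlaquette_closes_large_b₀`; p. 257 "b₀ is a sufficiently large absolute constant"), or beyond a threshold in
    x_i if `2p₀ > 3r₀ + 2` (`perPlaquette_closes_threshold`), or — [9]'s form — if `r₀ ≥ 2`, `2p₀ > 4r₀`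
    (`perPlaquette_closes_via_B2`, through `B2.coeff354_threshold`);
  – FAILURE of the per-plaquette balance when `2p₀ < 3r₀ + 2` (`perPlaquette_fails`: along B10's progression the
    penalty eventually exceeds the gain by any prescribed amount), and `printed_hypotheses_admit_failure`: the printed
    constraints (p₀ > 2, (7) p. 257; r₀ free; [9]'s r ≥ 2) admit such parameters (p₀ = 3, r₀ = 2).  Worded
    throughout as "the delegated bookkeeping, as organised in [9] §3.C, does not close under the printed hypotheses
    alone" — no theorem of the paper is claimed false (the repair is the unprinted choice 2p₀ ≥ 3r₀ + 2, resp. [9]'s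
    2p ≥ (d+1)r with r ≥ 2);
* k = 0: the leaf "no interaction terms at k = 0" ((1) p. 256, the empty sum of (43)) discharges, together with (46),
  the interaction hypothesis `hP` of `B10.thm1Compact_of_thm2` at EVERY k ≤ K (`interaction_all_steps`,
  `thm1Compact_of_thm2_leaves`; gen 1's `B10.Pint_le_of_bound46` covered 1 ≤ k only);
* p. 262 [8] "exp(−R), which is smaller than arbitrary power of ε": `expNegR_le_eps_pow` (what it needs: 2N ≤ R₁x^{r₀−1}).

WHAT IS NOT HERE.  The summation over admissible sequences {Ω_j} itself ([9] (3.46) ⇒ (3.47), "after some easy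
transformations") and the covering geometry (3.43)–(3.52) — the SOURCE side, `…Balaban1983to89.B2` (cell GAPS G-pv04-2,
surge node pv04's sibling `B2Sect3C`); the production of the small factors (67)–(71) (leaf, `B10.LargeFieldControlPrinted`
docstring; (70)/(71) arithmetic `B10.eq70_sq_step`/`B10.eq71_arith`).  Value = typed skeleton + kernel-checked census of
one delegated step, NOT summit progress; d = 3 throughout (cell DIVERGENCE D-r2.1).
-/

namespace Literature.MathematicalPhysics.QuantumFieldTheory.Balaban1983to89.B10LargeField

open Finset Real
open Literature.MathematicalPhysics.QuantumFieldTheory.Balaban1983to89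

/-! ## Sect. B p. 266 and pp. 267–268: the geometric setting (38)–(40) and the rule for Ω_{k+1} -/

section GeometricSetting

/-- SCHEMATIC carrier for the geometric setting of Sect. B (p. 266 [12]) and the rule of pp. 267–268 [13–14].
`Pt` = the points of the fine torus T_η (all domains are subsets of it: (38) "Ω_j ⊂ T_η"); `Ω j` = Ω_j for j ≥ 1; the
index-0 entry `Ω 0` enters the facts below only through hypotheses `x ∉ Ω 0` (vacuous when `Ω 0 = T_η`, the convention
of (42) p. 266 *"where we have put Λ₀ = Ω₁ᶜ"*; it is NOT the auxiliary neighbourhood Ω₀ ⊃ Ω₁ of p. 257, which plays no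
role here); `P j` = the points covered by the large-field
plaquettes of the decomposition of unity made at the passage j → j+1 (p. 267 [13]: *"We introduce the decomposition of
unity (7) for the field V on the domain Λ_k, with ε₁ = g_kp(g_k)"*; p. 273 [19]: *"a plaquette p′ ⊂ Λ_j and such that
|V_j(∂p′) − 1| ≥ g_jp(g_j)"*); `bdist j x y` = the distance, in units of the Lʲη-lattice, between the big blocks (of the
size M₁Lʲη) containing x and y (`bdist_self`: a block is at distance 0 from itself); `collar j` = R(g_j)M₁ of (39).  The
multi-lattice bookkeeping (traces Ω_j⁽ʲ⁾ on the Lʲη-lattices, "Here the sets Z_j are rescaled to the unit scale", p. 266)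
is NOT modelled: cell DIVERGENCE.md D-b10.6.  Only NAMES the printed objects. [cite: Balaban1985UV3, (38)–(39) p.266; pp.267–268] -/
structure DomainSeq where
  Pt : Type
  Ω : ℕ → Set Pt
  P : ℕ → Set Pt
  bdist : ℕ → Pt → Pt → ℝ
  bdist_self : ∀ j x, bdist j x x = 0
  collar : ℕ → ℝ

/-- p. 266 [12], verbatim: *"and we denote Z_j = Ω_{j+1}⁽ʲ⁾ᶜ ⊂ T⁽ʲ⁾_{Lʲη}. Gauge field configurations V_j are defined on Z_j,
j = 0, 1, …, k − 1"*; p. 268 [14]: *"Z_k = B(Λ_{k+1})ᶜ"*. [cite: Balaban1985UV3, p.266] -/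
def Z (D : DomainSeq) (j : ℕ) : Set D.Pt := (D.Ω (j + 1))ᶜ

/-- p. 266 [12], verbatim: *"We define the sets Λ_j, 𝔅 as in [5], i.e. Λ_j = Ω_j⁽ʲ⁾∖Ω_{j+1}⁽ʲ⁾"*; p. 268 [14]: *"We change
the definition of Λ_k, taking Λ_k = Ω_k⁽ᵏ⁾∖Ω_{k+1}⁽ᵏ⁾, and we define Λ_{k+1} = Ω_{k+1}⁽ᵏ⁺¹⁾, hence Ω_{k+1}⁽ᵏ⁾ = B(Λ_{k+1})"*.
[cite: Balaban1985UV3, p.266 + p.268] -/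
def Λ (D : DomainSeq) (j : ℕ) : Set D.Pt := D.Ω j \ D.Ω (j + 1)

/-- **(38)** p. 266 [12], verbatim: *"Thus we obtain a sequence of domains Ω₁ ⊃ Ω₂ ⊃ ⋯ ⊃ Ω_k, Ω_j ⊂ T_η, (38)"*.
[cite: Balaban1985UV3, (38) p.266] -/
def Nested38 (D : DomainSeq) : Prop := ∀ j, D.Ω (j + 1) ⊆ D.Ω j

/-- **(39)** p. 266 [12], verbatim: *"satisfying the conditions (Lʲη)⁻¹ dist(Ω_jᶜ, Ω_{j+1}) > R(g_j)M₁, R(g_j) = R₁r(g_j),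
(39)  Ω_j is a union of big blocks of the size M₁Lʲη."* (`r(g) = (1 + log g⁻¹)^{r₀}`: `B10.rFun`; p. 257 [3] *"We take
R = R₁(1 + log g₀⁻¹)^{r₀} = R₁r(g₀)"*.)  Typed: every point outside Ω_j is at block distance > R(g_j)M₁ from every point
of Ω_{j+1}. [cite: Balaban1985UV3, (39) p.266] -/
def Sep39 (D : DomainSeq) : Prop :=
  ∀ j (x y : D.Pt), x ∉ D.Ω j → y ∈ D.Ω (j + 1) → D.collar j < D.bdist j x y

/-- **The rule for Ω_{k+1}**, pp. 267–268 [13–14], verbatim: *"We introduce the decomposition of unity (7) for the field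
V on the domain Λ_k, with ε₁ = g_kp(g_k). Let us denote the field variables V by V_k, and the new fields by V. We define
the set Ω_{k+1}⁽ᵏ⁾ as a union of big blocks of the lattice T₁⁽ᵏ⁾, with distances to P ∪ Ω_k⁽ᵏ⁾ᶜ greater than R(g_k)M₁."*
(first step, p. 257 [3]: *"to each term of the decomposition we assign a subset Ω₁ ⊂ T₁ defined as a union of big
blocks, i.e. blocks of the size M₁, of the unit lattice T₁, such that their distances to P are > RM₁"*; p. 266 [12]:
*"the only difference is that we take blocks with distances to P ∪ Ω₁ᶜ greater than RM₁, where R = R₁r(g₁)"*.)  Typed as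
what the rule IMPOSES on the chosen blocks: every point of Ω_{j+1} is at block distance > R(g_j)M₁ from P_j and from
Ω_jᶜ.  (The maximal reading "Ω_{j+1} = the union of ALL such blocks" is `Rule268Max`; the facts below use only this
direction.) [cite: Balaban1985UV3, pp.267–268; p.257; p.266] -/
def Rule268 (D : DomainSeq) : Prop :=
  ∀ j (y : D.Pt), y ∈ D.Ω (j + 1) → ∀ x : D.Pt, (x ∈ D.P j ∨ x ∉ D.Ω j) → D.collar j < D.bdist j x y

/-- The maximal reading of the same rule ("THE union of the big blocks with distances … greater than R(g_k)M₁"): a point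
whose block is R(g_j)M₁-far from P_j ∪ Ω_jᶜ belongs to Ω_{j+1}.  Recorded for the source-side count ([9] (3.52): the
complement is COVERED by the collars); not used below. [cite: Balaban1985UV3, pp.267–268] -/
def Rule268Max (D : DomainSeq) : Prop :=
  ∀ j (y : D.Pt), (∀ x : D.Pt, (x ∈ D.P j ∨ x ∉ D.Ω j) → D.collar j < D.bdist j x y) → y ∈ D.Ω (j + 1)

/-- **(40)** p. 266 [12], verbatim: *"Finally characteristic functions χ_j are generalizations of the characteristic
function χ₁ and are defined by χ_j = Π_{p∈Λ_j} χ({|V_j(∂p) − 1| < 2L²g_{j−1}p(g_{j−1})}), j = 1, …, k, (40) where we have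
denoted V_k = V."*  Typed over an abstract plaquette set with `dev p = |V_j(∂p) − 1|` (a nonnegative real per plaquette;
the group-valued holonomy is not modelled): the support condition of χ_j. [cite: Balaban1985UV3, (40) p.266] -/
def Chi40 {Pl : Type} (Λj : Set Pl) (dev : Pl → ℝ) (L gprev b₀ p₀ : ℝ) : Prop :=
  ∀ p ∈ Λj, dev p < 2 * L ^ 2 * gprev * B10.pFun b₀ p₀ gprev

/-- rule ⇒ **(38)**: a point of Ω_{j+1} outside Ω_j would be at positive block distance from itself.  Needs only
`R(g_j)M₁ ≥ 0`.  Re-derived, kernel-checked. [cite: Balaban1985UV3, (38) p.266] -/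
theorem nested38_of_rule268 (D : DomainSeq) (hR : ∀ j, 0 ≤ D.collar j) (h : Rule268 D) : Nested38 D := by
  intro j y hy
  by_contra hx
  have h1 := h j y hy y (Or.inr hx)
  rw [D.bdist_self] at h1
  exact absurd h1 (not_lt.mpr (hR j))

/-- rule ⇒ **(39)** (the Ω_jᶜ half of the rule is (39) verbatim).  Re-derived, kernel-checked. [cite: Balaban1985UV3, (39) p.266] -/
theorem sep39_of_rule268 (D : DomainSeq) (h : Rule268 D) : Sep39 D :=
  fun j x y hx hy => h j y hy x (Or.inr hx)

/-- rule ⇒ the large-field plaquettes found at the passage j → j+1 lie in Z_j = Ω_{j+1}ᶜ (first step, p. 257 [3],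
verbatim: *"By this definition p ⊂ Ω₁ᶜ, in fact dist(P, Ω₁) > RM₁"*; p. 273 [19]: *"a plaquette p′ ⊂ Λ_j"*, Λ_j ⊂ Z_j).
Re-derived, kernel-checked. [cite: Balaban1985UV3, p.257 + p.268 + p.273] -/
theorem largeField_subset_Z (D : DomainSeq) (hR : ∀ j, 0 ≤ D.collar j) (h : Rule268 D) (j : ℕ) :
    D.P j ⊆ Z D j := by
  intro x hx hmem
  have h1 := h j x hmem x (Or.inl hx)
  rw [D.bdist_self] at h1
  exact absurd h1 (not_lt.mpr (hR j))

/-- Λ_j ⊂ Z_j (definitional). [cite: Balaban1985UV3, p.266] -/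
theorem Λ_subset_Z (D : DomainSeq) (j : ℕ) : Λ D j ⊆ Z D j := fun _ hx => hx.2

/-- (38) ⇒ the complements increase: Z_j ⊂ Z_{j+1} (as subsets of T_η; p. 266: the Z_j "are rescaled to the unit
scale" only when their volumes are taken).  Re-derived. [cite: Balaban1985UV3, (38) p.266] -/
theorem Z_mono (D : DomainSeq) (h38 : Nested38 D) (j : ℕ) : Z D j ⊆ Z D (j + 1) :=
  fun _ hx hx' => hx (h38 (j + 1) hx')

/-- Iterated form of `Z_mono`: Z_i ⊂ Z_j for i ≤ j. [cite: Balaban1985UV3, (38) p.266] -/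
theorem Z_mono_le (D : DomainSeq) (h38 : Nested38 D) {i j : ℕ} (hij : i ≤ j) : Z D i ⊆ Z D j := by
  induction j with
  | zero =>
    have hi : i = 0 := Nat.le_zero.mp hij
    subst hi; exact le_rfl
  | succ j ih =>
    rcases Nat.eq_or_lt_of_le hij with h | h
    · subst h; exact le_rfl
    · exact le_trans (ih (Nat.lt_succ_iff.mp h)) (Z_mono D h38 j)

/-- rule ⇒ the closed R(g_j)M₁-collar (block distance) of P_j ∪ Ω_jᶜ lies in Z_j — the contrapositive of the rule.
[cite: Balaban1985UV3, pp.267–268] -/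
theorem collar_subset_Z (D : DomainSeq) (h : Rule268 D) (j : ℕ) (x y : D.Pt) (hx : x ∈ D.P j ∨ x ∉ D.Ω j)
    (hy : D.bdist j x y ≤ D.collar j) : y ∈ Z D j :=
  fun hy' => (not_lt.mpr hy) (h j y hy' x hx)

/-- **The mechanism of the entropy count** (cell GAPS G-adv2-7: *"A plaquette that turns large at scale i forces, by
(39), a corridor of width R(g_j)M₁ (scale-j units) around it at every j ≥ i"*): under the rule, for a large-field
plaquette point `p ∈ P_i` and every later scale `j ≥ i`, the whole R(g_j)M₁-collar of p (block distance at scale j)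
lies in Z_j.  Proof: p ∈ Z_i ⊂ Z_{j−1} = Ω_jᶜ, then the rule at scale j.  Re-derived, kernel-checked over the schematic
carrier. [cite: Balaban1985UV3, (39) p.266 + pp.267–268] -/
theorem collar_all_scales (D : DomainSeq) (hR : ∀ j, 0 ≤ D.collar j) (h : Rule268 D) {i j : ℕ} (hij : i ≤ j)
    {p : D.Pt} (hp : p ∈ D.P i) (y : D.Pt) (hy : D.bdist j p y ≤ D.collar j) : y ∈ Z D j := by
  rcases Nat.eq_or_lt_of_le hij with hEq | hlt
  · subst hEq
    exact collar_subset_Z D h i p y (Or.inl hp) hy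
  · have hpZ : p ∈ Z D (j - 1) :=
      Z_mono_le D (nested38_of_rule268 D hR h) (by omega) (largeField_subset_Z D hR h i hp)
    have hj : j - 1 + 1 = j := by omega
    have hpΩ : p ∉ D.Ω j := by
      have : p ∈ (D.Ω (j - 1 + 1))ᶜ := hpZ
      rw [hj] at this
      exact this
    exact collar_subset_Z D h j p y (Or.inr hpΩ) hy

end GeometricSetting

/-! ## k = 0: no interaction terms ((1) p. 256, (43) p. 266) — the missing case of `B10.Pint_le_of_bound46` -/

section StepZero

/-- **(1)** p. 256 [2], verbatim: *"ρ₀(U) = exp[−(1/g₀²)A(U) − E]"*, and (41)/(43) p. 266 [12]: the interaction sum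
`Σ_{j=1}^{k} Σ_{Y_j} 𝒫_j(Y_j, U_k)` is EMPTY at k = 0.  Leaf over gen 1's carrier: `Pint 0 ≡ 0` (an identity about the
objects the carrier only names; companion of `B10.Step0Printed`). [cite: Balaban1985UV3, (1) p.256 + (43) p.266] -/
def NoInteraction0 (T : B10.TowerRun) : Prop := ∀ (h : T.Hist 0) (U : T.Cfg 0), T.Pint 0 h U = 0

/-- Sect. D first line (p. 272 [18]: *"We estimate the interaction terms using the bounds (44)–(46) by
O(1)M₁³g²_{k−1}p²(g_{k−1})|Λ_k| ≤ O(1)|T₁⁽ᵏ⁾|"*) for a FAMILY of runs and ALL steps: if the interaction terms vanish at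
k = 0 ((1)) and are bounded by `a|T₁⁽ᵏ⁾|` with one `a ≥ 0` for 1 ≤ k ≤ K (from (46): `B10.Pint_le_of_bound46`,
`interaction_uniform_of_46` below), then the hypothesis `hP` of `B10.thm1Compact_of_thm2` holds at every k ≤ K.
Re-derived bookkeeping. [cite: Balaban1985UV3, Sect. D p.272] -/
theorem interaction_all_steps {I : Type} (T : I → B10.TowerRun) (h0 : ∀ i, NoInteraction0 (T i)) (a : ℝ)
    (ha : 0 ≤ a)
    (hP1 : ∀ i k, 1 ≤ k → k ≤ (T i).K → ∀ (h : (T i).Hist k) (U : (T i).Cfg k),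
      |(T i).Pint k h U| ≤ a * (T i).sites k) :
    ∀ i k, k ≤ (T i).K → ∀ (h : (T i).Hist k) (U : (T i).Cfg k), |(T i).Pint k h U| ≤ a * (T i).sites k := by
  intro i k hk h U
  rcases Nat.eq_zero_or_pos k with hk0 | hkpos
  · subst hk0
    rw [h0 i h U, abs_zero]
    exact mul_nonneg ha ((T i).sites_nonneg 0)
  · exact hP1 i k hkpos hk h U

/-- **(46) with constants common to the family ⇒ a uniform `a`.**  If all runs use the same M₁ ≥ 0, b₀, p₀ > 0 (absolute
constants of the construction: (7) and the big-block size M₁, p. 257 [3]) and (46) holds with one O(1) = `C ≥ 0`, and every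
`g_{k−1} ∈ (0, 1]`, then `|Σ𝒫| ≤ a|T₁⁽ᵏ⁾|` for 1 ≤ k ≤ K with the HONEST constant
`a = C M₁³ b₀² p₀^{2p₀} e^{2−2p₀}` (`B10.gsq_psq_le`: g²p²(g) ≤ b₀²p₀^{2p₀}e^{2−2p₀} on (0, 1]).  The single-run version is
`B10.Pint_le_of_bound46`. [cite: Balaban1985UV3, (46) p.267 + Sect. D p.272] -/
theorem interaction_uniform_of_46 {I : Type} (T : I → B10.TowerRun) (C M₁ b₀ p₀ : ℝ) (hC : 0 ≤ C) (hM : 0 ≤ M₁)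
    (hp : 0 < p₀) (hpar : ∀ i, (T i).M₁ = M₁ ∧ (T i).b₀ = b₀ ∧ (T i).p₀ = p₀)
    (h46 : ∀ i k, 1 ≤ k → k ≤ (T i).K → ∀ (h : (T i).Hist k) (U : (T i).Cfg k),
      |(T i).Pint k h U| ≤ C * (T i).M₁ ^ 3 *
        (((T i).g (k - 1)) ^ 2 * (B10.pFun (T i).b₀ (T i).p₀ ((T i).g (k - 1))) ^ 2) * (T i).Λvol k h)
    (hg : ∀ i k, k ≤ (T i).K → 0 < (T i).g k ∧ (T i).g k ≤ 1)
    (hΛ : ∀ i (k : ℕ) (h : (T i).Hist k), 0 ≤ (T i).Λvol k h) :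
    ∀ i k, 1 ≤ k → k ≤ (T i).K → ∀ (h : (T i).Hist k) (U : (T i).Cfg k),
      |(T i).Pint k h U| ≤ (C * M₁ ^ 3 * (b₀ ^ 2 * (p₀ ^ (2 * p₀) * Real.exp (2 - 2 * p₀)))) * (T i).sites k := by
  intro i k hk1 hkK h U
  obtain ⟨hM₁, hb₀, hp₀⟩ := hpar i
  have h46i := h46 i k hk1 hkK h U
  rw [hM₁, hb₀, hp₀] at h46i
  have hgk := hg i (k - 1) (by omega)
  have hgp := B10.gsq_psq_le b₀ p₀ ((T i).g (k - 1)) hp hgk.1 hgk.2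
  have hCM : 0 ≤ C * M₁ ^ 3 := mul_nonneg hC (pow_nonneg hM 3)
  calc |(T i).Pint k h U|
      ≤ C * M₁ ^ 3 * (((T i).g (k - 1)) ^ 2 * (B10.pFun b₀ p₀ ((T i).g (k - 1))) ^ 2) * (T i).Λvol k h :=
        h46i
    _ ≤ C * M₁ ^ 3 * (b₀ ^ 2 * (p₀ ^ (2 * p₀) * Real.exp (2 - 2 * p₀))) * (T i).Λvol k h :=
        mul_le_mul_of_nonneg_right (mul_le_mul_of_nonneg_left hgp hCM) (hΛ i k h)
    _ ≤ C * M₁ ^ 3 * (b₀ ^ 2 * (p₀ ^ (2 * p₀) * Real.exp (2 - 2 * p₀))) * (T i).sites k :=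
        mul_le_mul_of_nonneg_left ((T i).Λvol_le k h) (mul_nonneg hCM (by positivity))

/-- **Theorem 1 (compact reading) from Theorem 2 with the interaction hypothesis discharged from the printed leaves**
((1) at k = 0, (46) uniformly for k ≥ 1): `B10.thm1Compact_of_thm2` with `hP` replaced by `NoInteraction0` + a uniform
(46)-bound.  The remaining hypotheses are gen 1's: (65) with the window-dependent constant (`hE`), the remainder (`hR`)
and the large-field control delegated to [9] (`hLF` = the shape of `B10.LargeFieldControlPrinted`, see
`LargeFieldControlVia9` below).  Re-derived bookkeeping, kernel-checked. [cite: Balaban1985UV3, Sect. D pp.272–274] -/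
theorem thm1Compact_of_thm2_leaves {I : Type} (T : I → B10.TowerRun) (hspec : ∀ i, B10.SpecOK (T i))
    (h2 : B10.Thm2Printed (fun i => (T i).toRunData))
    (h0 : ∀ i, NoInteraction0 (T i)) (a c d : ℝ) (ha : 0 ≤ a) (hd : 0 ≤ d) (b : ℝ → ℝ → ℝ)
    (hP1 : ∀ i k, 1 ≤ k → k ≤ (T i).K → ∀ (h : (T i).Hist k) (U : (T i).Cfg k),
      |(T i).Pint k h U| ≤ a * (T i).sites k)
    (hE : ∀ gmin gmax : ℝ, ∀ i k, k ≤ (T i).K → gmin ≤ (T i).g k → (T i).g k ≤ gmax →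
      |(T i).Ecst k| ≤ b gmin gmax * (T i).sites k)
    (hR : ∀ i k, k ≤ (T i).K → (T i).Rm k ≤ c * (T i).sites k)
    (hLF : ∀ i k, k ≤ (T i).K → ∀ U : (T i).Cfg k,
      (T i).LF k U (fun h => -((T i).mainT k h U) + (T i).Zterm k h) ≤ Real.exp (d * (T i).sites k)) :
    B10.Thm1PrintedCompact (fun i => (T i).toRunData) :=
  B10.thm1Compact_of_thm2 T hspec h2 a c d hd b (interaction_all_steps T h0 a ha hP1) hE hR hLF

end StepZero

/-! ## The logarithmic unit of (7) along the flow, and the dictionary with [9]'s unit -/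

section Dictionary

/-- `x(g) = 1 + log g⁻¹`, the unit in which (7) p. 257 [3] writes `p(g) = b₀(1 + log g⁻¹)^{p₀}` and
`r(g) = (1 + log g⁻¹)^{r₀}` (`B10.pFun`, `B10.rFun`). [cite: Balaban1985UV3, (7) p.257] -/
noncomputable def xlog (g : ℝ) : ℝ := 1 + Real.log g⁻¹

/-- `p(g) = b₀ x(g)^{p₀}` (definitional). [cite: Balaban1985UV3, (7) p.257] -/
theorem pFun_eq (b₀ p₀ g : ℝ) : B10.pFun b₀ p₀ g = b₀ * xlog g ^ p₀ := rfl

/-- `r(g) = x(g)^{r₀}` (definitional). [cite: Balaban1985UV3, (7) p.257] -/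
theorem rFun_eq (r₀ g : ℝ) : B10.rFun r₀ g = xlog g ^ r₀ := rfl

/-- `x(g) ≥ 1` for `g ∈ (0, 1]`. [folklore] -/
theorem one_le_xlog {g : ℝ} (hg : 0 < g) (hg1 : g ≤ 1) : 1 ≤ xlog g := by
  unfold xlog
  linarith [B10.log_inv_nonneg_of_le_one hg hg1]

/-- Along the d = 3 flow `g_k = g(Lᵏε)^{1/2}` (p. 256) the unit DEcreases by `½ log L` per step:
`x(g_j) = x(g_K) + (K − j)·½ log L` for j ≤ K (from `B10.log_gRun_shift`).  So a large-field plaquette created at scale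
i and carried to the end of the run lives through `K − i = (x(g_i) − x(g_K))/(½ log L)` scales. [cite: Balaban1985UV3, (5) p.256] -/
theorem xlog_gRun (g L ε : ℝ) (hg : 0 < g) (hL : 0 < L) (hε : 0 < ε) {j K : ℕ} (hj : j ≤ K) :
    xlog (B10.gRun g L ε j) = xlog (B10.gRun g L ε K) + ((K - j : ℕ) : ℝ) * (Real.log L / 2) := by
  have h := B10.log_gRun_shift g L ε hg hL hε j (K - j)
  rw [Nat.add_sub_cancel' hj] at h
  unfold xlog
  rw [Real.log_inv, Real.log_inv, h]
  ring

/-- The same progression written from the top, in the form of `B2.inner353_bound`'s variable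
`x_k = 1 + ℓ − k·logL` with `ℓ = log g₀⁻¹` and `logL = ½ log L`. [cite: Balaban1985UV3, (5) p.256] -/
theorem xlog_gRun_affine (g L ε : ℝ) (hg : 0 < g) (hL : 0 < L) (hε : 0 < ε) (k : ℕ) :
    xlog (B10.gRun g L ε k) = 1 + Real.log (B10.gRun g L ε 0)⁻¹ - (k : ℝ) * (Real.log L / 2) := by
  have h := B10.log_gRun_shift g L ε hg hL hε 0 k
  rw [zero_add] at h
  unfold xlog
  rw [Real.log_inv, Real.log_inv, h]
  ring

/-- **Dictionary with [9].**  [Balaban1982Higgs2] measures everything in `1 + log(Lᵏε)⁻¹` (`B2.pFn`, `B2.rFn`); B10's unit is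
`x(g_k) = x(g) + ½ log(Lᵏε)⁻¹` — the bare coupling enters only as the constant `x(g)`. [cite: Balaban1985UV3, (5) p.256; (7) p.257] -/
theorem xlog_gRun_eq_half (g L ε : ℝ) (hg : 0 < g) (hL : 0 < L) (hε : 0 < ε) (k : ℕ) :
    xlog (B10.gRun g L ε k) = xlog g + Real.log (L ^ k * ε)⁻¹ / 2 := by
  unfold xlog B10.gRun
  have h1 : 0 < L ^ k * ε := by positivity
  have h2 : Real.log (g * Real.sqrt (L ^ k * ε)) = Real.log g + Real.log (L ^ k * ε) / 2 := by
    rw [Real.log_mul hg.ne' (Real.sqrt_pos.mpr h1).ne', Real.log_sqrt h1.le]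
  simp only [Real.log_inv, h2]
  ring

/-- Two-sided comparison of the units for `g ≤ 1` and `Lᵏε ≤ 1`:
`½(1 + log(Lᵏε)⁻¹) ≤ x(g_k) ≤ x(g)·(1 + log(Lᵏε)⁻¹)` — so every polynomial condition "x large / x-powers compared" of
[9] §3.C transfers to B10's unit with g-dependent constants (ε₀ = ε₀(g), p. 256). [cite: Balaban1985UV3, (5) p.256; (7) p.257] -/
theorem xlog_gRun_bounds (g L ε : ℝ) (hg : 0 < g) (hg1 : g ≤ 1) (hL : 0 < L) (hε : 0 < ε) (k : ℕ)
    (hk : L ^ k * ε ≤ 1) :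
    (1 + Real.log (L ^ k * ε)⁻¹) / 2 ≤ xlog (B10.gRun g L ε k) ∧
      xlog (B10.gRun g L ε k) ≤ xlog g * (1 + Real.log (L ^ k * ε)⁻¹) := by
  rw [xlog_gRun_eq_half g L ε hg hL hε k]
  have hx : 1 ≤ xlog g := one_le_xlog hg hg1
  have h0 : 0 < L ^ k * ε := by positivity
  have hy : 0 ≤ Real.log (L ^ k * ε)⁻¹ := by
    rw [Real.log_inv]
    have := Real.log_nonpos h0.le hk
    linarith
  constructor
  · linarith
  · nlinarith

end Dictionary

/-! ## Sect. D pp. 273–274: the transfer to [9] Sect. 3.C — exponent bookkeeping per large-field plaquette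

p. 273 [19], verbatim: *"We obtain a bound of the form (41) with the expression
−(1/g_k²)A^η(U_k) + Σ_{j=0}^{k−1} O(log g_j⁻¹)|Z_j| + O(1)|T₁⁽ᵏ⁾|, (66) in the exponential. To prove the inequality (5)
we have to produce all small factors connected with large fields regions P in the functions ζ_{Λ_j}. Let us take a
plaquette p′ ⊂ Λ_j and such that |V_j(∂p′) − 1| ≥ g_jp(g_j)."* … *"This inequality can be written finally as
(1/g_k²)Σ_{p⊂Δ′} η⁻¹[1 − Re tr U_k(∂p)] ≥ (1/2g_j²)|V_j(∂p′) − 1|² − O(1)g_jp³(g_j) ≥ ½p²(g_j) − O(1)g_jp³(g_j) ≥ ¼p²(g_j)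
(71) for g_j sufficiently small. Thus the part of the action 1/g_k²A^η(U_k) localized to the sum of four j-blocks Δ′
connected with the plaquette p′ can be bounded from below by 1/4p²(g_j), and the corresponding part of the exponential
gives the small factor exp(−1/4p²(g_j)). We get these small factors for all plaquettes in all large fields set P.
Results related to stability bound (70) have been obtained by P. Federbush in [17, 18]. The analysis of Sect. 3.C [9],
which is model independent, show that these"* — p. 274 [20] — *"small factors are enough to control all sums in (41),
together with the second term in (65) ⟦sic: (66)⟧. This gives the upper bound in (5)."*

Against the small factors, (41) p. 266 [12] (= (66)) carries `+ Σ_{j=0}^{k−1} O(log g_j⁻¹)|Z_j|` in the exponent, and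
by (39) / the p. 268 rule (`collar_all_scales`) a plaquette large at scale i contributes to |Z_j| a collar of
≍ (R(g_j)M₁)³ sites at every j ≥ i (p. 266: *"Here the sets Z_j are rescaled to the unit scale"*).  [9] organises the
count per large-field cube and additively over the scales ((3.52)–(3.54) p. 594: `B2.inner353_bound`,
`B2.coeff354_nonneg`, `B2.coeff354_threshold`); the declarations below run that organisation in B10's unit
x = 1 + log g⁻¹ with `R(g)M₁ = ρx^{r₀}` (ρ = R₁M₁), penalty rate `O(log g_j⁻¹) ≤ A·x_j`, gain `¼p² = ¼b₀²x^{2p₀}`. -/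

section EntropyBookkeeping

/-- The volume penalty of ONE scale for one large-field plaquette, in the per-cube organisation of [9] (3.52)–(3.53):
rate `A·x` (for (41)'s O(log g_j⁻¹), log g⁻¹ ≤ x) times collar volume `(ρx^{r₀})³` (ρ = R₁M₁; (39)), written as
`A·(ρ³·x^{3r₀}·x)` to match `B2.inner353_bound`'s summand (`penaltyTerm_eq`). [cite: Balaban1985UV3, (39)+(41) p.266] -/
noncomputable def penaltyTerm (A ρ r₀ x : ℝ) : ℝ := A * (ρ ^ 3 * x ^ (r₀ * 3) * x)

/-- `penaltyTerm A ρ r₀ x = A·x·(ρx^{r₀})³` for x ≥ 0. [folklore] -/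
theorem penaltyTerm_eq (A ρ r₀ x : ℝ) (hx : 0 ≤ x) :
    penaltyTerm A ρ r₀ x = A * x * (ρ * x ^ r₀) ^ 3 := by
  unfold penaltyTerm
  have h3 : x ^ (r₀ * 3) = (x ^ r₀) ^ (3 : ℕ) := by
    rw [Real.rpow_mul hx, show (3 : ℝ) = ((3 : ℕ) : ℝ) by norm_num, Real.rpow_natCast]
  rw [h3, mul_pow]
  ring

/-- `penaltyTerm` is monotone in x on [0, ∞) for A, ρ, r₀ ≥ 0. [folklore] -/
theorem penaltyTerm_mono {A ρ r₀ x y : ℝ} (hA : 0 ≤ A) (hρ : 0 ≤ ρ) (hr : 0 ≤ r₀) (hx : 0 ≤ x) (hxy : x ≤ y) :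
    penaltyTerm A ρ r₀ x ≤ penaltyTerm A ρ r₀ y := by
  unfold penaltyTerm
  have hy : 0 ≤ y := le_trans hx hxy
  have h1 : x ^ (r₀ * 3) ≤ y ^ (r₀ * 3) := Real.rpow_le_rpow hx hxy (by positivity)
  have h2 : 0 ≤ y ^ (r₀ * 3) := Real.rpow_nonneg hy _
  apply mul_le_mul_of_nonneg_left _ hA
  calc ρ ^ 3 * x ^ (r₀ * 3) * x ≤ ρ ^ 3 * y ^ (r₀ * 3) * x := by gcongr
    _ ≤ ρ ^ 3 * y ^ (r₀ * 3) * y := mul_le_mul_of_nonneg_left hxy (mul_nonneg (pow_nonneg hρ 3) h2)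

/-- An honest LOWER model of the same penalty — rate `a·log g⁻¹ = a(x − 1)` and collar `(cρx^{r₀})³` with geometry
constant c — dominates `penaltyTerm (a/2) (cρ) r₀ x` once x ≥ 2 (i.e. g ≤ e⁻¹), so the failure statement below applies
to it as well. [folklore] -/
theorem penaltyTerm_lower_model {a c ρ r₀ x : ℝ} (ha : 0 ≤ a) (hcρ : 0 ≤ c * ρ) (hx : 2 ≤ x) :
    penaltyTerm (a / 2) (c * ρ) r₀ x ≤ a * (x - 1) * (c * ρ * x ^ r₀) ^ 3 := by
  rw [penaltyTerm_eq _ _ _ _ (by linarith)]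
  have h3 : 0 ≤ (c * ρ * x ^ r₀) ^ 3 := pow_nonneg (mul_nonneg hcρ (Real.rpow_nonneg (by linarith) _)) 3
  have : a / 2 * x ≤ a * (x - 1) := by nlinarith
  exact mul_le_mul_of_nonneg_right this h3

/-- The TOTAL volume penalty charged to one plaquette that is large at scale i in a run of K steps (it meets Z_j for
every j = i, …, K − 1 by `collar_all_scales`), along B10's progression `x(g_j) = x_K + (K − j)ℓ`, ℓ = ½ log L
(`xlog_gRun`): `Σ_{j=i}^{K−1} A·x_j·(ρx_j^{r₀})³`. [cite: Balaban1985UV3, (41) p.266 + pp.273–274] -/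
noncomputable def penalty (A ρ r₀ xK ℓ : ℝ) (i K : ℕ) : ℝ :=
  ∑ j ∈ Ico i K, penaltyTerm A ρ r₀ (xK + ((K - j : ℕ) : ℝ) * ℓ)

/-- Every term of `penalty` is ≥ 0 (A, ρ ≥ 0, x_K ≥ 0, ℓ ≥ 0). [folklore] -/
theorem penaltyTerm_nonneg {A ρ r₀ x : ℝ} (hA : 0 ≤ A) (hρ : 0 ≤ ρ) (hx : 0 ≤ x) : 0 ≤ penaltyTerm A ρ r₀ x := by
  unfold penaltyTerm
  exact mul_nonneg hA (mul_nonneg (mul_nonneg (pow_nonneg hρ 3) (Real.rpow_nonneg hx _)) hx)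

/-- **[9]'s (3.53) step, literally**, for B10's penalty: with `r₀ ≥ 2` ([9] p. 594 *"and r ≥ 2"*), `x_K ≥ 1`
(g_K = gε₀^{1/2} ≤ 1: [9]'s *"K − k ≤ (log L)⁻¹ log(Lᵏε)⁻¹"*), ℓ = ½ log L > 0 and i < K:
`penalty ≤ A·ρ³·x_i^{4r₀}/ℓ` — an INSTANCE of `B2.inner353_bound` (d = 3, R = ρ, r = r₀, logL = ℓ,
ℓ_there = x_K + Kℓ − 1).  Kernel-checked edge B10 Sect. D → [9] (3.53). [cite: Balaban1985UV3, pp.273–274; Balaban1982Higgs2, (3.53) p.594] -/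
theorem penalty_le_via_B2 {A ρ r₀ ℓ xK : ℝ} (hA : 0 ≤ A) (hρ : 0 ≤ ρ) (hr : 2 ≤ r₀) (hℓ : 0 < ℓ)
    (hxK : 1 ≤ xK) {i K : ℕ} (hi : i < K) :
    penalty A ρ r₀ xK ℓ i K ≤ A * (ρ ^ 3 * (xK + ((K - i : ℕ) : ℝ) * ℓ) ^ (r₀ * 4) / ℓ) := by
  have hB2 := @B2.inner353_bound ρ r₀ ℓ (xK + (K : ℝ) * ℓ - 1) 3 K i hρ hr hℓ (by linarith) hi
  have hcast : ∀ j, j ≤ K → (1 + (xK + (K : ℝ) * ℓ - 1) - (j : ℝ) * ℓ) = xK + ((K - j : ℕ) : ℝ) * ℓ := by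
    intro j hj
    push_cast [Nat.cast_sub hj]
    ring
  have hsum : ∑ j ∈ Ico i K, ρ ^ 3 * (1 + (xK + (K : ℝ) * ℓ - 1) - (j : ℝ) * ℓ) ^ (r₀ * (3 : ℕ))
        * (1 + (xK + (K : ℝ) * ℓ - 1) - (j : ℝ) * ℓ)
      = ∑ j ∈ Ico i K, ρ ^ 3 * (xK + ((K - j : ℕ) : ℝ) * ℓ) ^ (r₀ * 3) * (xK + ((K - j : ℕ) : ℝ) * ℓ) := by
    refine sum_congr rfl fun j hj => ?_
    rw [mem_Ico] at hj
    rw [hcast j hj.2.le]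
    norm_num
  have hrhs : ρ ^ 3 * (1 + (xK + (K : ℝ) * ℓ - 1) - (i : ℝ) * ℓ) ^ (r₀ * (((3 : ℕ) : ℝ) + 1)) / ℓ
      = ρ ^ 3 * (xK + ((K - i : ℕ) : ℝ) * ℓ) ^ (r₀ * 4) / ℓ := by
    rw [hcast i hi.le]
    norm_num
  rw [hsum, hrhs] at hB2
  unfold penalty penaltyTerm
  rw [← mul_sum]
  exact mul_le_mul_of_nonneg_left hB2 hA

/-- B10's OWN count of the same sum, valid for every `r₀ ≥ 0`: each of the K − i terms is ≤ ρ³x_i^{3r₀}·x_i and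
`(K − i)ℓ = x_i − x_K ≤ x_i`, so `penalty ≤ A·ρ³·x_i^{3r₀+2}/ℓ`.  The exponent `3r₀ + 2` is what the gain `2p₀` must beat
(cell GAPS G-adv2-7 / G-B10-02); [9]'s cruder `4r₀ ≥ 3r₀ + 2` is where its "r ≥ 2" enters (`B2.inner353_bound`,
GAPS G-pv04-2). Re-derived, kernel-checked. [cite: Balaban1985UV3, (39)+(41) p.266, pp.273–274] -/
theorem penalty_le_B10count {A ρ r₀ ℓ xK : ℝ} (hA : 0 ≤ A) (hρ : 0 ≤ ρ) (hr : 0 ≤ r₀) (hℓ : 0 < ℓ)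
    (hxK : 1 ≤ xK) (i K : ℕ) :
    penalty A ρ r₀ xK ℓ i K ≤ A * (ρ ^ 3 * (xK + ((K - i : ℕ) : ℝ) * ℓ) ^ (r₀ * 3 + 2) / ℓ) := by
  set x : ℕ → ℝ := fun j => xK + ((K - j : ℕ) : ℝ) * ℓ with hxdef
  have hx0 : ∀ j, 0 < x j := by
    intro j
    simp only [hxdef]
    have : 0 ≤ ((K - j : ℕ) : ℝ) * ℓ := mul_nonneg (Nat.cast_nonneg _) hℓ.le
    linarith
  have hxi : 0 < x i := hx0 i
  have hmono : ∀ j ∈ Ico i K, x j ≤ x i := by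
    intro j hj
    rw [mem_Ico] at hj
    simp only [hxdef]
    have : ((K - j : ℕ) : ℝ) ≤ ((K - i : ℕ) : ℝ) := by exact_mod_cast Nat.sub_le_sub_left hj.1 K
    nlinarith
  have hterm : ∀ j ∈ Ico i K, ρ ^ 3 * (x j) ^ (r₀ * 3) * x j ≤ ρ ^ 3 * (x i) ^ (r₀ * 3) * x i := by
    intro j hj
    have hxj := hx0 j
    have hji := hmono j hj
    have h1 : (x j) ^ (r₀ * 3) ≤ (x i) ^ (r₀ * 3) := Real.rpow_le_rpow hxj.le hji (by positivity)
    have h2 : 0 ≤ (x i) ^ (r₀ * 3) := Real.rpow_nonneg hxi.le _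
    calc ρ ^ 3 * (x j) ^ (r₀ * 3) * x j ≤ ρ ^ 3 * (x i) ^ (r₀ * 3) * x j := by gcongr
      _ ≤ ρ ^ 3 * (x i) ^ (r₀ * 3) * x i :=
          mul_le_mul_of_nonneg_left hji (mul_nonneg (pow_nonneg hρ 3) h2)
  have hcard : ((Ico i K).card : ℝ) = ((K - i : ℕ) : ℝ) := by rw [Nat.card_Ico]
  have hcount : ((K - i : ℕ) : ℝ) * ℓ ≤ x i := by
    simp only [hxdef]
    linarith
  have hsum : ∑ j ∈ Ico i K, ρ ^ 3 * (x j) ^ (r₀ * 3) * x j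
      ≤ ((K - i : ℕ) : ℝ) * (ρ ^ 3 * (x i) ^ (r₀ * 3) * x i) := by
    calc ∑ j ∈ Ico i K, ρ ^ 3 * (x j) ^ (r₀ * 3) * x j ≤ ∑ j ∈ Ico i K, ρ ^ 3 * (x i) ^ (r₀ * 3) * x i :=
          sum_le_sum hterm
      _ = ((Ico i K).card : ℝ) * (ρ ^ 3 * (x i) ^ (r₀ * 3) * x i) := by rw [sum_const, nsmul_eq_mul]
      _ = ((K - i : ℕ) : ℝ) * (ρ ^ 3 * (x i) ^ (r₀ * 3) * x i) := by rw [hcard]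
  have hpow : (x i) ^ (r₀ * 3) * x i * x i = (x i) ^ (r₀ * 3 + 2) := by
    rw [Real.rpow_add hxi, Real.rpow_two]
    ring
  have hnn : 0 ≤ ρ ^ 3 * (x i) ^ (r₀ * 3) * x i :=
    mul_nonneg (mul_nonneg (pow_nonneg hρ 3) (Real.rpow_nonneg hxi.le _)) hxi.le
  have key : ((K - i : ℕ) : ℝ) * (ρ ^ 3 * (x i) ^ (r₀ * 3) * x i) * ℓ ≤ ρ ^ 3 * (x i) ^ (r₀ * 3 + 2) := by
    calc ((K - i : ℕ) : ℝ) * (ρ ^ 3 * (x i) ^ (r₀ * 3) * x i) * ℓ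
        = (((K - i : ℕ) : ℝ) * ℓ) * (ρ ^ 3 * (x i) ^ (r₀ * 3) * x i) := by ring
      _ ≤ x i * (ρ ^ 3 * (x i) ^ (r₀ * 3) * x i) := mul_le_mul_of_nonneg_right hcount hnn
      _ = ρ ^ 3 * ((x i) ^ (r₀ * 3) * x i * x i) := by ring
      _ = ρ ^ 3 * (x i) ^ (r₀ * 3 + 2) := by rw [hpow]
  have hfin : ∑ j ∈ Ico i K, ρ ^ 3 * (x j) ^ (r₀ * 3) * x j ≤ ρ ^ 3 * (x i) ^ (r₀ * 3 + 2) / ℓ := by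
    rw [le_div_iff₀ hℓ]
    exact le_trans (mul_le_mul_of_nonneg_right hsum hℓ.le) key
  unfold penalty penaltyTerm
  rw [← mul_sum]
  exact mul_le_mul_of_nonneg_left hfin hA

/-- **Balance under "b₀ sufficiently large"** (p. 257 [3]: *"p₀ > 2 and b₀ is a sufficiently large absolute
constant"*): if the penalty exponent q is ≤ 2p₀ and `8D ≤ b₀²`, then `D·x^q ≤ ⅛(b₀x^{p₀})² = ⅛p²` for every x ≥ 1 —
no threshold in x needed. [folklore: real arithmetic, cite: Balaban1985UV3, (7) p.257] -/
theorem balance_of_large_b₀ {D b₀ p₀ q x : ℝ} (hx : 1 ≤ x) (hq : q ≤ 2 * p₀) (hD : 0 ≤ D)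
    (hb : 8 * D ≤ b₀ ^ 2) : D * x ^ q ≤ (b₀ * x ^ p₀) ^ 2 / 8 := by
  have hx0 : 0 < x := by linarith
  have h1 : x ^ q ≤ x ^ (2 * p₀) := Real.rpow_le_rpow_of_exponent_le hx hq
  have h2 : x ^ (2 * p₀) = (x ^ p₀) ^ 2 := by rw [mul_comm, Real.rpow_mul hx0.le, Real.rpow_two]
  have h3 : 0 ≤ x ^ (2 * p₀) := Real.rpow_nonneg hx0.le _
  calc D * x ^ q ≤ D * x ^ (2 * p₀) := mul_le_mul_of_nonneg_left h1 hD
    _ ≤ (b₀ ^ 2 / 8) * x ^ (2 * p₀) := mul_le_mul_of_nonneg_right (by linarith) h3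
    _ = (b₀ * x ^ p₀) ^ 2 / 8 := by rw [mul_pow, ← h2]; ring

/-- **Balance under "ε₀ sufficiently small"** (all x(g_k) ≥ x(g_K) = 1 + log(gε₀^{1/2})⁻¹ large): if the penalty
exponent is STRICTLY below 2p₀ then beyond a threshold x₀ ≥ 1, `D·x^q ≤ ⅛(b₀x^{p₀})²` — an instance of
`B2.coeff354_threshold` (d = 0, R = 1, c₀ = ⅛), i.e. [9]'s "(3.54) if 2p ≥ (d+1)r and ε₀ is sufficiently small" in its
strict form. [folklore: real arithmetic, cite: Balaban1982Higgs2, (3.54) p.594] -/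
theorem balance_threshold {D b₀ p₀ q : ℝ} (hq : q < 2 * p₀) (hD : 0 ≤ D) (hb : 0 < b₀) :
    ∃ x₀ : ℝ, 1 ≤ x₀ ∧ ∀ x, x₀ ≤ x → D * x ^ q ≤ (b₀ * x ^ p₀) ^ 2 / 8 := by
  obtain ⟨x₀, hx₀, h⟩ := @B2.coeff354_threshold (1 / 8) b₀ D 1 p₀ q 0 (by norm_num) hb hD zero_le_one
    (by push_cast; linarith)
  refine ⟨x₀, hx₀, fun x hx => ?_⟩
  have hx1 : 1 ≤ x := le_trans hx₀ hx
  have hx0 : 0 < x := by linarith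
  have key := h x hx
  simp only [one_pow, mul_one, Nat.cast_zero, zero_add, one_mul] at key
  have h2 : x ^ (2 * p₀) = (x ^ p₀) ^ 2 := by rw [mul_comm, Real.rpow_mul hx0.le, Real.rpow_two]
  have hxq : 0 ≤ x ^ q := Real.rpow_nonneg hx0.le _
  calc D * x ^ q ≤ (1 / 8 * b₀ ^ 2 * x ^ (2 * p₀ - q)) * x ^ q := mul_le_mul_of_nonneg_right key hxq
    _ = b₀ ^ 2 * (x ^ (2 * p₀ - q) * x ^ q) / 8 := by ring
    _ = b₀ ^ 2 * x ^ (2 * p₀) / 8 := by rw [← Real.rpow_add hx0, sub_add_cancel]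
    _ = (b₀ * x ^ p₀) ^ 2 / 8 := by rw [mul_pow, ← h2]

/-- The per-plaquette NET exponent: gain `−¼p²` ((71)) plus a penalty `≤ ⅛p²` is `≤ −⅛p²` — half of the small factor
survives, which is the form in which [9] §3.C then sums over positions and scales. [cite: Balaban1985UV3, (71) p.273] -/
theorem netExponent_le {pen b₀ p₀ x : ℝ} (h : pen ≤ (b₀ * x ^ p₀) ^ 2 / 8) :
    -((b₀ * x ^ p₀) ^ 2 / 4) + pen ≤ -((b₀ * x ^ p₀) ^ 2 / 8) := by linarith

/-- **Sufficiency, B10's count, "b₀ large" form.**  If `r₀ ≥ 0`, `3r₀ + 2 ≤ 2p₀` and `8Aρ³/ℓ ≤ b₀²` (ℓ = ½ log L,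
ρ = R₁M₁), then for EVERY large-field plaquette (any scale i < K of any run with x(g_K) ≥ 1):
`−¼p²(g_i) + penalty ≤ −⅛p²(g_i)`, p(g_i) = b₀x_i^{p₀}.  Re-derived, kernel-checked; the proviso `3r₀ + 2 ≤ 2p₀` is NOT
printed (print: "p₀ > 2", r₀ free — cell GAPS G-adv2-7 / G-B10-02). [cite: Balaban1985UV3, (7) p.257, (41) p.266, (71) pp.273–274] -/
theorem perPlaquette_closes_large_b₀ {A ρ r₀ ℓ xK b₀ p₀ : ℝ} (hA : 0 ≤ A) (hρ : 0 ≤ ρ) (hr : 0 ≤ r₀)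
    (hℓ : 0 < ℓ) (hxK : 1 ≤ xK) (hp : r₀ * 3 + 2 ≤ 2 * p₀) (hb : 8 * (A * ρ ^ 3 / ℓ) ≤ b₀ ^ 2)
    (i K : ℕ) :
    -((b₀ * (xK + ((K - i : ℕ) : ℝ) * ℓ) ^ p₀) ^ 2 / 4) + penalty A ρ r₀ xK ℓ i K
      ≤ -((b₀ * (xK + ((K - i : ℕ) : ℝ) * ℓ) ^ p₀) ^ 2 / 8) := by
  apply netExponent_le
  have hx1 : 1 ≤ xK + ((K - i : ℕ) : ℝ) * ℓ := by
    have : 0 ≤ ((K - i : ℕ) : ℝ) * ℓ := mul_nonneg (Nat.cast_nonneg _) hℓ.le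
    linarith
  have hD : 0 ≤ A * ρ ^ 3 / ℓ := div_nonneg (mul_nonneg hA (pow_nonneg hρ 3)) hℓ.le
  calc penalty A ρ r₀ xK ℓ i K ≤ A * (ρ ^ 3 * (xK + ((K - i : ℕ) : ℝ) * ℓ) ^ (r₀ * 3 + 2) / ℓ) :=
        penalty_le_B10count hA hρ hr hℓ hxK i K
    _ = (A * ρ ^ 3 / ℓ) * (xK + ((K - i : ℕ) : ℝ) * ℓ) ^ (r₀ * 3 + 2) := by ring
    _ ≤ _ := balance_of_large_b₀ hx1 hp hD hb

/-- **Sufficiency, B10's count, threshold form** ("ε₀(g) sufficiently small": x(g_K) ≥ x₀): if `3r₀ + 2 < 2p₀` there is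
x₀ ≥ 1 such that every large-field plaquette with x(g_i) ≥ x₀ has net exponent ≤ −⅛p²(g_i).  Re-derived. [cite: Balaban1985UV3, (71) pp.273–274; (2) p.256 "ε₀ … depending on the coupling constant g only"] -/
theorem perPlaquette_closes_threshold {A ρ r₀ ℓ xK b₀ p₀ : ℝ} (hA : 0 ≤ A) (hρ : 0 ≤ ρ) (hr : 0 ≤ r₀)
    (hℓ : 0 < ℓ) (hxK : 1 ≤ xK) (hb : 0 < b₀) (hp : r₀ * 3 + 2 < 2 * p₀) :
    ∃ x₀ : ℝ, 1 ≤ x₀ ∧ ∀ i K : ℕ, x₀ ≤ xK + ((K - i : ℕ) : ℝ) * ℓ →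
      -((b₀ * (xK + ((K - i : ℕ) : ℝ) * ℓ) ^ p₀) ^ 2 / 4) + penalty A ρ r₀ xK ℓ i K
        ≤ -((b₀ * (xK + ((K - i : ℕ) : ℝ) * ℓ) ^ p₀) ^ 2 / 8) := by
  have hD : 0 ≤ A * ρ ^ 3 / ℓ := div_nonneg (mul_nonneg hA (pow_nonneg hρ 3)) hℓ.le
  obtain ⟨x₀, hx₀, h⟩ := balance_threshold (D := A * ρ ^ 3 / ℓ) (b₀ := b₀) (p₀ := p₀) hp hD hb
  refine ⟨x₀, hx₀, fun i K hx => netExponent_le ?_⟩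
  calc penalty A ρ r₀ xK ℓ i K ≤ A * (ρ ^ 3 * (xK + ((K - i : ℕ) : ℝ) * ℓ) ^ (r₀ * 3 + 2) / ℓ) :=
        penalty_le_B10count hA hρ hr hℓ hxK i K
    _ = (A * ρ ^ 3 / ℓ) * (xK + ((K - i : ℕ) : ℝ) * ℓ) ^ (r₀ * 3 + 2) := by ring
    _ ≤ _ := h _ hx

/-- **Sufficiency in [9]'s own form**: `r₀ ≥ 2` and `4r₀ < 2p₀` (= "2p ≥ (d+1)r" at d = 3, strict, with "r ≥ 2",
[Balaban1982Higgs2] p. 594) give a threshold x₀ beyond which every large-field plaquette has net exponent ≤ −⅛p²(g_i) —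
through `penalty_le_via_B2` (= `B2.inner353_bound`) and `balance_threshold` (= `B2.coeff354_threshold`).  This is the
typed content of "The analysis of Sect. 3.C [9], which is model independent" AT THE LEVEL OF ITS EXPONENT ARITHMETIC;
the provisos r₀ ≥ 2, 2p₀ > 4r₀ are [9]'s, not B10's print. [cite: Balaban1985UV3, pp.273–274; Balaban1982Higgs2, (3.53)–(3.54) p.594] -/
theorem perPlaquette_closes_via_B2 {A ρ r₀ ℓ xK b₀ p₀ : ℝ} (hA : 0 ≤ A) (hρ : 0 ≤ ρ) (hr : 2 ≤ r₀)
    (hℓ : 0 < ℓ) (hxK : 1 ≤ xK) (hb : 0 < b₀) (hp : r₀ * 4 < 2 * p₀) :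
    ∃ x₀ : ℝ, 1 ≤ x₀ ∧ ∀ i K : ℕ, i < K → x₀ ≤ xK + ((K - i : ℕ) : ℝ) * ℓ →
      -((b₀ * (xK + ((K - i : ℕ) : ℝ) * ℓ) ^ p₀) ^ 2 / 4) + penalty A ρ r₀ xK ℓ i K
        ≤ -((b₀ * (xK + ((K - i : ℕ) : ℝ) * ℓ) ^ p₀) ^ 2 / 8) := by
  have hD : 0 ≤ A * ρ ^ 3 / ℓ := div_nonneg (mul_nonneg hA (pow_nonneg hρ 3)) hℓ.le
  obtain ⟨x₀, hx₀, h⟩ := balance_threshold (D := A * ρ ^ 3 / ℓ) (b₀ := b₀) (p₀ := p₀) hp hD hb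
  refine ⟨x₀, hx₀, fun i K hi hx => netExponent_le ?_⟩
  calc penalty A ρ r₀ xK ℓ i K ≤ A * (ρ ^ 3 * (xK + ((K - i : ℕ) : ℝ) * ℓ) ^ (r₀ * 4) / ℓ) :=
        penalty_le_via_B2 hA hρ hr hℓ hxK hi
    _ = (A * ρ ^ 3 / ℓ) * (xK + ((K - i : ℕ) : ℝ) * ℓ) ^ (r₀ * 4) := by ring
    _ ≤ _ := h _ hx

/-- [9]'s proviso implies B10's: `r₀ ≥ 2 ∧ 4r₀ ≤ 2p₀ ⇒ 3r₀ + 2 ≤ 2p₀`. [folklore] -/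
theorem proviso_B2_implies_B10count {p₀ r₀ : ℝ} (hr : 2 ≤ r₀) (h : r₀ * 4 ≤ 2 * p₀) :
    r₀ * 3 + 2 ≤ 2 * p₀ := by linarith

/-- **The printed hypotheses admit parameters for which neither proviso holds**: p₀ = 3 > 2 ((7) p. 257: *"p₀ > 2"*),
r₀ = 2 (r₀ is never fixed in B10; [9] p. 594 uses r ≥ 2, (2.7) there r > 1): then `2p₀ = 6 < 8 = 3r₀ + 2 = 4r₀`.
[cite: Balaban1985UV3, (7) p.257; Balaban1982Higgs2, p.594] -/
theorem printed_hypotheses_admit_failure :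
    ∃ p₀ r₀ : ℝ, 2 < p₀ ∧ 2 ≤ r₀ ∧ 2 * p₀ < r₀ * 3 + 2 ∧ 2 * p₀ < r₀ * 4 :=
  ⟨3, 2, by norm_num, by norm_num, by norm_num, by norm_num⟩

/-- A lower bound for the penalty by the s terms j with `K − j ∈ (s, 2s]` (each ≥ the term at x = (s+1)ℓ), for
`2s ≤ K − i`: `penalty ≥ s · penaltyTerm A ρ r₀ ((s+1)ℓ)`. [folklore: finite sums] -/
theorem penalty_lower_aux {A ρ r₀ ℓ xK : ℝ} (hA : 0 ≤ A) (hρ : 0 ≤ ρ) (hr : 0 ≤ r₀) (hℓ : 0 ≤ ℓ)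
    (hxK : 0 ≤ xK) {i K s : ℕ} (hs : 2 * s ≤ K - i) :
    (s : ℝ) * penaltyTerm A ρ r₀ (((s : ℝ) + 1) * ℓ) ≤ penalty A ρ r₀ xK ℓ i K := by
  have hsub : Ico (K - 2 * s) (K - s) ⊆ Ico i K := by
    intro j hj
    rw [mem_Ico] at hj ⊢
    omega
  have hnn : ∀ j ∈ Ico i K, 0 ≤ penaltyTerm A ρ r₀ (xK + ((K - j : ℕ) : ℝ) * ℓ) := by
    intro j _
    exact penaltyTerm_nonneg hA hρ (by have := mul_nonneg (Nat.cast_nonneg (K - j)) hℓ; linarith)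
  have hcard : (Ico (K - 2 * s) (K - s)).card = s := by rw [Nat.card_Ico]; omega
  have hlow : ∀ j ∈ Ico (K - 2 * s) (K - s),
      penaltyTerm A ρ r₀ (((s : ℝ) + 1) * ℓ) ≤ penaltyTerm A ρ r₀ (xK + ((K - j : ℕ) : ℝ) * ℓ) := by
    intro j hj
    rw [mem_Ico] at hj
    have hKj : s + 1 ≤ K - j := by omega
    have hcast : (s : ℝ) + 1 ≤ ((K - j : ℕ) : ℝ) := by exact_mod_cast hKj
    apply penaltyTerm_mono hA hρ hr (by positivity)
    nlinarith
  calc (s : ℝ) * penaltyTerm A ρ r₀ (((s : ℝ) + 1) * ℓ)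
      = ∑ j ∈ Ico (K - 2 * s) (K - s), penaltyTerm A ρ r₀ (((s : ℝ) + 1) * ℓ) := by
        rw [sum_const, nsmul_eq_mul, hcard]
    _ ≤ ∑ j ∈ Ico (K - 2 * s) (K - s), penaltyTerm A ρ r₀ (xK + ((K - j : ℕ) : ℝ) * ℓ) := sum_le_sum hlow
    _ ≤ penalty A ρ r₀ xK ℓ i K := sum_le_sum_of_subset_of_nonneg hsub (fun j hj _ => hnn j hj)

/-- **FAILURE of the per-plaquette balance when `2p₀ < 3r₀ + 2`.**  With A, ρ, ℓ > 0 (a positive rate for (41)'s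
O(log g_j⁻¹), a collar of positive size, L > 1), r₀, p₀ ≥ 0 and x(g_K) ≥ 1: for every b₀ and every M there is N such
that every plaquette that is large N or more scales before the end of the run (K − i ≥ N — at fixed physical scale this
is forced as ε → 0) has `¼p²(g_i) + M ≤ penalty`, i.e. its net exponent in the per-cube organisation of [9] §3.C is
≥ +M.  Hence, under the printed "p₀ > 2" with such r₀ (`printed_hypotheses_admit_failure`), the delegated bookkeeping
does not close as organised; the choice 2p₀ ≥ 3r₀ + 2 (resp. [9]'s 2p ≥ (d+1)r, r ≥ 2) is a hypothesis B10 does not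
print.  No step of the paper is asserted false.  Re-derived real analysis, kernel-checked. [cite: Balaban1985UV3, (7) p.257, (39)+(41) p.266, (71) pp.273–274] -/
theorem perPlaquette_fails {A ρ r₀ ℓ xK b₀ p₀ : ℝ} (hA : 0 < A) (hρ : 0 < ρ) (hr : 0 ≤ r₀) (hℓ : 0 < ℓ)
    (hxK : 1 ≤ xK) (hp0 : 0 ≤ p₀) (hp : 2 * p₀ < r₀ * 3 + 2) (M : ℝ) :
    ∃ N : ℕ, ∀ i K : ℕ, i + N ≤ K →
      (b₀ * (xK + ((K - i : ℕ) : ℝ) * ℓ) ^ p₀) ^ 2 / 4 + M ≤ penalty A ρ r₀ xK ℓ i K := by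
  -- constants: gain ≤ c₁ s^{2p₀}, penalty ≥ c₂ s^{3r₀+2} with s = ⌊(K−i)/2⌋
  set c₁ : ℝ := b₀ ^ 2 * (xK + 3 * ℓ) ^ (2 * p₀) / 4 with hc₁
  set c₂ : ℝ := A * ρ ^ 3 * ℓ ^ (r₀ * 3) * ℓ with hc₂
  set δ : ℝ := r₀ * 3 + 2 - 2 * p₀ with hδ
  have hδ0 : 0 < δ := by rw [hδ]; linarith
  have hc₁0 : 0 ≤ c₁ := by rw [hc₁]; positivity
  have hc₂0 : 0 < c₂ := by rw [hc₂]; positivity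
  set Q : ℝ := (c₁ + |M|) / c₂ with hQ
  have hQ0 : 0 ≤ Q := by rw [hQ]; positivity
  set S₀ : ℝ := Q ^ (1 / δ) with hS₀
  have hS₀0 : 0 ≤ S₀ := by rw [hS₀]; exact Real.rpow_nonneg hQ0 _
  refine ⟨2 * ⌈S₀⌉₊ + 2, fun i K hK => ?_⟩
  set n : ℕ := K - i with hn
  have hnN : 2 * ⌈S₀⌉₊ + 2 ≤ n := by rw [hn]; omega
  set s : ℕ := n / 2 with hsdef
  have hs1 : ⌈S₀⌉₊ + 1 ≤ s := by rw [hsdef]; omega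
  have hs2 : 2 * s ≤ n := by rw [hsdef]; omega
  have hn2 : n ≤ 2 * s + 1 := by rw [hsdef]; omega
  have hsR1 : (1 : ℝ) ≤ s := by exact_mod_cast (show 1 ≤ s by omega)
  have hsR0 : (0 : ℝ) < s := by linarith
  have hsS₀ : S₀ ≤ s := by
    have h1 : S₀ ≤ ⌈S₀⌉₊ := Nat.le_ceil S₀
    have h2 : ((⌈S₀⌉₊ : ℕ) : ℝ) + 1 ≤ s := by exact_mod_cast hs1
    linarith
  -- Q ≤ s^δ
  have hQs : Q ≤ (s : ℝ) ^ δ := by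
    have h1 : S₀ ^ δ ≤ (s : ℝ) ^ δ := Real.rpow_le_rpow hS₀0 hsS₀ hδ0.le
    have h2 : S₀ ^ δ = Q := by
      rw [hS₀, ← Real.rpow_mul hQ0, one_div_mul_cancel hδ0.ne', Real.rpow_one]
    rw [h2] at h1
    exact h1
  -- (a) upper bound on the gain
  have hxi : xK + (n : ℝ) * ℓ ≤ (s : ℝ) * (xK + 3 * ℓ) := by
    have h1 : (n : ℝ) ≤ 2 * s + 1 := by exact_mod_cast hn2
    nlinarith
  have hxi0 : 0 ≤ xK + (n : ℝ) * ℓ := by positivity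
  have hgain : (b₀ * (xK + (n : ℝ) * ℓ) ^ p₀) ^ 2 / 4 ≤ c₁ * (s : ℝ) ^ (2 * p₀) := by
    have h1 : (xK + (n : ℝ) * ℓ) ^ (2 * p₀) ≤ ((s : ℝ) * (xK + 3 * ℓ)) ^ (2 * p₀) :=
      Real.rpow_le_rpow hxi0 hxi (by positivity)
    have h2 : ((s : ℝ) * (xK + 3 * ℓ)) ^ (2 * p₀) = (s : ℝ) ^ (2 * p₀) * (xK + 3 * ℓ) ^ (2 * p₀) :=
      Real.mul_rpow hsR0.le (by positivity)
    have h3 : (b₀ * (xK + (n : ℝ) * ℓ) ^ p₀) ^ 2 = b₀ ^ 2 * (xK + (n : ℝ) * ℓ) ^ (2 * p₀) := by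
      rw [mul_pow, mul_comm (2 : ℝ) p₀, Real.rpow_mul hxi0, Real.rpow_two]
    rw [h3, hc₁]
    have hb2 : 0 ≤ b₀ ^ 2 := sq_nonneg b₀
    calc b₀ ^ 2 * (xK + (n : ℝ) * ℓ) ^ (2 * p₀) / 4 ≤ b₀ ^ 2 * ((s : ℝ) * (xK + 3 * ℓ)) ^ (2 * p₀) / 4 := by
          gcongr
      _ = b₀ ^ 2 * (xK + 3 * ℓ) ^ (2 * p₀) / 4 * (s : ℝ) ^ (2 * p₀) := by rw [h2]; ring
  -- (b) lower bound on the penalty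
  have hpen : c₂ * (s : ℝ) ^ (r₀ * 3 + 2) ≤ penalty A ρ r₀ xK ℓ i K := by
    have haux := penalty_lower_aux (xK := xK) (i := i) (K := K) (s := s) hA.le hρ.le hr hℓ.le
      (le_trans zero_le_one hxK) (by rw [← hn]; exact hs2)
    refine le_trans ?_ haux
    -- c₂ s^{3r₀+2} ≤ s · A (ρ³ ((s+1)ℓ)^{3r₀} (s+1)ℓ)
    have hu : (s : ℝ) * ℓ ≤ ((s : ℝ) + 1) * ℓ := by nlinarith
    have hu0 : 0 ≤ (s : ℝ) * ℓ := by positivity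
    have h1 : ((s : ℝ) * ℓ) ^ (r₀ * 3) ≤ (((s : ℝ) + 1) * ℓ) ^ (r₀ * 3) :=
      Real.rpow_le_rpow hu0 hu (by positivity)
    have h2 : ((s : ℝ) * ℓ) ^ (r₀ * 3) = (s : ℝ) ^ (r₀ * 3) * ℓ ^ (r₀ * 3) := Real.mul_rpow hsR0.le hℓ.le
    have h3 : (s : ℝ) ^ (r₀ * 3 + 2) = (s : ℝ) ^ (r₀ * 3) * s * s := by
      rw [Real.rpow_add hsR0, Real.rpow_two]; ring
    have h4 : 0 ≤ (((s : ℝ) + 1) * ℓ) ^ (r₀ * 3) := Real.rpow_nonneg (by positivity) _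
    unfold penaltyTerm
    rw [hc₂, h3]
    calc A * ρ ^ 3 * ℓ ^ (r₀ * 3) * ℓ * ((s : ℝ) ^ (r₀ * 3) * s * s)
        = (s : ℝ) * (A * (ρ ^ 3 * ((s : ℝ) ^ (r₀ * 3) * ℓ ^ (r₀ * 3)) * ((s : ℝ) * ℓ))) := by ring
      _ ≤ (s : ℝ) * (A * (ρ ^ 3 * (((s : ℝ) + 1) * ℓ) ^ (r₀ * 3) * (((s : ℝ) + 1) * ℓ))) := by
          rw [← h2]
          apply mul_le_mul_of_nonneg_left _ hsR0.le
          apply mul_le_mul_of_nonneg_left _ hA.le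
          calc ρ ^ 3 * ((s : ℝ) * ℓ) ^ (r₀ * 3) * ((s : ℝ) * ℓ)
              ≤ ρ ^ 3 * (((s : ℝ) + 1) * ℓ) ^ (r₀ * 3) * ((s : ℝ) * ℓ) := by gcongr
            _ ≤ ρ ^ 3 * (((s : ℝ) + 1) * ℓ) ^ (r₀ * 3) * (((s : ℝ) + 1) * ℓ) :=
                mul_le_mul_of_nonneg_left hu (mul_nonneg (pow_nonneg hρ.le 3) h4)
  -- (c) comparison of the powers of s
  have hsp : (1 : ℝ) ≤ (s : ℝ) ^ (2 * p₀) := Real.one_le_rpow hsR1 (by positivity)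
  have hM : M ≤ |M| * (s : ℝ) ^ (2 * p₀) := by
    have := le_abs_self M
    nlinarith [abs_nonneg M]
  have hsplit : (s : ℝ) ^ (r₀ * 3 + 2) = (s : ℝ) ^ δ * (s : ℝ) ^ (2 * p₀) := by
    rw [← Real.rpow_add hsR0, hδ]; ring_nf
  have hfinal : (c₁ + |M|) * (s : ℝ) ^ (2 * p₀) ≤ c₂ * (s : ℝ) ^ (r₀ * 3 + 2) := by
    rw [hsplit, ← mul_assoc]
    apply mul_le_mul_of_nonneg_right _ (by positivity)
    have : c₁ + |M| = Q * c₂ := by rw [hQ, div_mul_cancel₀ _ hc₂0.ne']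
    rw [this, mul_comm]
    exact mul_le_mul_of_nonneg_left hQs hc₂0.le
  have hcast : ((K - i : ℕ) : ℝ) = (n : ℝ) := by rw [hn]
  rw [hcast]
  calc (b₀ * (xK + (n : ℝ) * ℓ) ^ p₀) ^ 2 / 4 + M ≤ c₁ * (s : ℝ) ^ (2 * p₀) + |M| * (s : ℝ) ^ (2 * p₀) :=
        add_le_add hgain hM
    _ = (c₁ + |M|) * (s : ℝ) ^ (2 * p₀) := by ring
    _ ≤ c₂ * (s : ℝ) ^ (r₀ * 3 + 2) := hfinal
    _ ≤ penalty A ρ r₀ xK ℓ i K := hpen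

end EntropyBookkeeping

/-! ## The delegated step as a leaf WITH its provisos, and p. 262's "exp(−R) smaller than arbitrary power of ε" -/

section TransferLeaf

/-- **The sentence of pp. 273–274 typed with the provisos of the delegated analysis explicit.**  Verbatim (p. 273 [19]
– p. 274 [20]): *"We get these small factors for all plaquettes in all large fields set P. Results related to stability
bound (70) have been obtained by P. Federbush in [17, 18]. The analysis of Sect. 3.C [9], which is model independent,
show that these small factors are enough to control all sums in (41), together with the second term in (65) ⟦sic:
(66)⟧. This gives the upper bound in (5)."*  [9] = [Balaban1982Higgs2], whose Sect. 3.C closes under *"2p ≥ (d+1)r and ε₀ is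
sufficiently small"* with *"r ≥ 2"* ((3.53)–(3.54) p. 594; `B2.inner353_bound`, `B2.coeff354_threshold`): at d = 3 and
in B10's exponents ((7): p(g) = b₀x^{p₀}, R(g) = R₁x^{r₀}) this reads `r₀ ≥ 2 ∧ 4r₀ ≤ 2p₀`, and "ε₀ small, g_j small"
((71): *"for g_j sufficiently small"*) as `g_k ∈ (0, 1]` along the run.  The leaf says: UNDER these provisos the
large-field history functional of (41) with the Z-terms is ≤ e^{d|T₁⁽ᵏ⁾|}, i.e. gen 1's `B10.LargeFieldControlPrinted`.
B10 prints neither proviso ("p₀ > 2", r₀ free: `printed_hypotheses_admit_failure`, `perPlaquette_fails`); the cell's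
located objection G-adv2-7 / G-B10-02 is exactly the antecedent.  A hypothesis, never asserted. [cite: Balaban1985UV3, pp.273–274; Balaban1982Higgs2, (3.53)–(3.54) p.594] -/
def LargeFieldControlVia9 (T : B10.TowerRun) (r₀ : ℝ) : Prop :=
  (2 ≤ r₀ ∧ r₀ * 4 ≤ 2 * T.p₀) → (∀ k, k ≤ T.K → 0 < T.g k ∧ T.g k ≤ 1) → B10.LargeFieldControlPrinted T

/-- Modus ponens: the provisos + the leaf give `B10.LargeFieldControlPrinted`, the `hLF` input of
`B10.thm1Compact_of_thm2` / `thm1Compact_of_thm2_leaves`.  Bookkeeping. [cite: Balaban1985UV3, pp.273–274] -/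
theorem largeFieldControl_of_via9 (T : B10.TowerRun) (r₀ : ℝ) (h : LargeFieldControlVia9 T r₀) (hr : 2 ≤ r₀)
    (hp : r₀ * 4 ≤ 2 * T.p₀) (hg : ∀ k, k ≤ T.K → 0 < T.g k ∧ T.g k ≤ 1) :
    B10.LargeFieldControlPrinted T :=
  h ⟨hr, hp⟩ hg

/-- p. 262 [8], verbatim: *"especially if X is not contained in a cube of the size RM₁, then the exponential factor in
(23) yields the factor exp(−R), which is smaller than arbitrary power of ε. We estimate all such expressions using this
bound and we get O(ε^κ)|T₁|."*  What the comparison needs, kernel-checked: with `x = 1 + log g₀⁻¹ ≥ 1`, `R = R₁x^{r₀}`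
and `log ε⁻¹ ≤ 2(x − 1)` (g₀ = gε^{1/2} with g ≤ 1: `log_eps_le`), IF `2N ≤ R₁x^{r₀−1}` then `exp(−R) ≤ ε^N`.  For
r₀ > 1 the proviso holds beyond a threshold in x (ε small); for r₀ = 1 it is the constant condition 2N ≤ R₁; for r₀ < 1
it fails for small ε — "arbitrary power" thus presupposes r₀ ≥ 1 with R₁ ≥ 2N, or r₀ > 1 (r₀ is never fixed in print;
cell GAPS G-adv2-7). [cite: Balaban1985UV3, p.262] -/
theorem expNegR_le_eps_pow {R₁ r₀ x N ε : ℝ} (hx : 1 ≤ x) (hN : 0 ≤ N) (hε : 0 < ε)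
    (hlog : Real.log ε⁻¹ ≤ 2 * (x - 1)) (hR : 2 * N ≤ R₁ * x ^ (r₀ - 1)) :
    Real.exp (-(R₁ * x ^ r₀)) ≤ ε ^ N := by
  have hx0 : 0 < x := by linarith
  have e1 : x ^ r₀ = x ^ (r₀ - 1) * x := by
    rw [← Real.rpow_add_one hx0.ne', sub_add_cancel]
  have h1 : 2 * N * (x - 1) ≤ R₁ * x ^ r₀ := by
    rw [e1, ← mul_assoc]
    have := mul_le_mul_of_nonneg_right hR hx0.le
    nlinarith
  have h2 : N * Real.log ε⁻¹ ≤ 2 * N * (x - 1) := by nlinarith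
  rw [Real.rpow_def_of_pos hε]
  apply Real.exp_le_exp.mpr
  rw [Real.log_inv] at h2
  nlinarith

/-- `log ε⁻¹ ≤ 2(x(g₀) − 1)` for `g₀ = gε^{1/2}` (`B10.gRun g L ε 0`) and `g ≤ 1`: `2(x(g₀) − 1) = 2 log g⁻¹ + log ε⁻¹`.
[cite: Balaban1985UV3, (5) p.256] -/
theorem log_eps_le (g L ε : ℝ) (hg : 0 < g) (hg1 : g ≤ 1) (hL : 0 < L) (hε : 0 < ε) :
    Real.log ε⁻¹ ≤ 2 * (xlog (B10.gRun g L ε 0) - 1) := by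
  rw [xlog_gRun_eq_half g L ε hg hL hε 0]
  simp only [pow_zero, one_mul]
  have hx : 1 ≤ xlog g := one_le_xlog hg hg1
  linarith

end TransferLeaf

end Literature.MathematicalPhysics.QuantumFieldTheory.Balaban1983to89.B10LargeField
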